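import Summits.NavierStokesRegularity.NavierStokesRegularity.Theses.CoreLogGas

/-!
# Crux A `CoreLogGas.LocallyDrivenIsTypeI` (stmt-NavierStokesRegularity-11290) is dominated by the shared target
# `NoTypeII` (stmt-NavierStokesRegularity-0056) — the formal dependency edge behind the c5 outcome `blocked-on`

`--supports stmt-NavierStokesRegularity-11290` (lead c5, 2026-08-17). Conditional results only; none closes the item.

Five line leads (c1 07:02Z, c2 07:28Z, c3 07:57Z, c4 12:42Z, c5) and nine refuter passes on the crux A found no engine for
it other than the route's own shared target `NoTypeII` (every maximal finite-energy classical solution from Clay data blows up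
at the Type-I rate), of which A is the restriction to solutions satisfying the locality hypothesis `H(M,t₀,g)`:
`locallyDrivenIsTypeI_of_noTypeII` below (one line). Why nothing weaker is available is recorded on the item
(`Cruxes/LocallyDrivenIsTypeI/Lines/registered-dead*.md`, `EvidenceC3.lean`: `H` is an UPPER bound on the exterior strain,
and upper bounds on vorticity growth only FLOOR a blow-up rate; a Type-I CAP needs a lower bound on the stretching at the
maximum or a monotone quantity, neither of which `H` supplies). This file makes the dominance a tree fact the route grader
can read: together with `locallyDrivenIsTypeI_of_continuation` (A by vacuity from the continuation statement, the
hypothesis of `NoBlowupToClay`) and `pair_iff_continuation` (modulo the shared `NoTypeIBlowup`, stmt-1217, the pair (A, B) is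
EQUIVALENT to that continuation statement), it shows that the A/B cut of route CoreLogGas re-partitions the continuation
problem rather than sitting below it.
-/

-- the summit and its single sub-problem share the name (D-0017), as in every Theorems file here
set_option linter.dupNamespace false

namespace Summit.NavierStokesRegularity.NavierStokesRegularity.Theorems.CoreLogGasLocallyDrivenIsTypeIOfNoTypeII

open Summit.NavierStokesRegularity.NavierStokesRegularity.Theses.CoreLogGas

/-- **A ⇐ NoTypeII (stmt-0056).** The crux `LocallyDrivenIsTypeI` is the shared target `NoTypeII` restricted to the
solutions satisfying the locality hypothesis `H`; conditional on `NoTypeII` it holds by dropping `H`. -/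
theorem locallyDrivenIsTypeI_of_noTypeII (h : NoTypeII) : LocallyDrivenIsTypeI :=
  fun ν T hν hT u p hmax hlh hdec _ => h ν T hν hT u p hmax hlh hdec

/-- Registered helper stub `stub_dominance` (lead c5; NOT a composition stub of line `registered`): the dominance edge
`NoTypeII → LocallyDrivenIsTypeI` in the gate's stub format (fully qualified signature). -/
theorem stub_dominance :
    Summit.NavierStokesRegularity.NavierStokesRegularity.Theses.CoreLogGas.NoTypeII →
      Summit.NavierStokesRegularity.NavierStokesRegularity.Theses.CoreLogGas.LocallyDrivenIsTypeI :=
  locallyDrivenIsTypeI_of_noTypeII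

/-- **A ⇐ continuation.** If every classical Leray–Hopf solution from rapidly decaying data on `[0,T)` extends smoothly
past `T` (the hypothesis of `NoBlowupToClay`, i.e. the shared continuation statement stmt-0054), there is no maximal
solution and `LocallyDrivenIsTypeI` holds vacuously. -/
theorem locallyDrivenIsTypeI_of_continuation
    (h : ∀ (ν T : ℝ), 0 < ν → 0 < T →
      ∀ (u : ℝ → EuclideanSpace ℝ (Fin 3) → EuclideanSpace ℝ (Fin 3)) (p : ℝ → EuclideanSpace ℝ (Fin 3) → ℝ),
        Literature.Analysis.FluidPDE.IsClassicalNSSolutionOn (Set.Ico 0 T) ν 0 u p →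
        Literature.Analysis.FluidPDE.IsLerayHopfOn T ν 0 (u 0) u →
        Literature.Analysis.FluidPDE.HasRapidSpatialDecay (u 0) →
        Literature.Analysis.FluidPDE.HasSmoothExtensionPast ν 0 u T) :
    LocallyDrivenIsTypeI :=
  fun ν T hν hT u p hmax hlh hdec _ => (hmax.2 (h ν T hν hT u p hmax.1 hlh hdec)).elim

/-- **A ∧ B ⇒ NoTypeII** (the route's composition: B supplies `H`, A converts it into the Type-I rate). -/
theorem noTypeII_of_pair (hA : LocallyDrivenIsTypeI) (hB : BlowupIsLocallyDriven) : NoTypeII :=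
  fun ν T hν hT u p hmax hlh hdec => hA ν T hν hT u p hmax hlh hdec (hB ν T hν hT u p hmax hlh hdec)

/-- **Modulo the shared `NoTypeIBlowup` (stmt-1217), the pair (A, B) is equivalent to the continuation statement.**
Forward: a non-extendable solution would be maximal, hence Type I by `noTypeII_of_pair`, hence extendable by
`NoTypeIBlowup`. Backward: vacuity (no maximal solution exists). -/
theorem pair_iff_continuation (hI : NoTypeIBlowup) :
    (LocallyDrivenIsTypeI ∧ BlowupIsLocallyDriven) ↔
      ∀ (ν T : ℝ), 0 < ν → 0 < T →
        ∀ (u : ℝ → EuclideanSpace ℝ (Fin 3) → EuclideanSpace ℝ (Fin 3)) (p : ℝ → EuclideanSpace ℝ (Fin 3) → ℝ),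
          Literature.Analysis.FluidPDE.IsClassicalNSSolutionOn (Set.Ico 0 T) ν 0 u p →
          Literature.Analysis.FluidPDE.IsLerayHopfOn T ν 0 (u 0) u →
          Literature.Analysis.FluidPDE.HasRapidSpatialDecay (u 0) →
          Literature.Analysis.FluidPDE.HasSmoothExtensionPast ν 0 u T := by
  constructor
  · rintro ⟨hA, hB⟩ ν T hν hT u p hcl hlh hdec
    by_contra hext
    exact hext (hI ν T hν hT u p hcl hlh hdec (noTypeII_of_pair hA hB ν T hν hT u p ⟨hcl, hext⟩ hlh hdec))
  · intro h
    exact ⟨locallyDrivenIsTypeI_of_continuation h,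
      fun ν T hν hT u p hmax hlh hdec => (hmax.2 (h ν T hν hT u p hmax.1 hlh hdec)).elim⟩

end Summit.NavierStokesRegularity.NavierStokesRegularity.Theorems.CoreLogGasLocallyDrivenIsTypeIOfNoTypeII
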